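import Literature.AlgebraicGeometry.Frobenioids.ArchimedeanBasicPropertiesSchemaNegativeD
import Literature.AlgebraicGeometry.Frobenioids.ArchimedeanTheoremsInstances
import HarnessLib

/-!
# Frobenioids II, Theorem 3.6 (ix) at `C^Λ` and `A`: the `Λ`-indexed INSTANCE statement
# `Thm36ix_CA π pf rlf` over the completion INTERFACE (FACT-LIST F-0879) has a REFUTABLE universal
# closure — it is a fact AT THE CONSTRUCTED DATA only (part C)

Mochizuki, *The geometry of Frobenioids II: poly-Frobenioids*, Kyushu J. Math. **62** (2008) 401–460,
§3, Example 3.3 (ii) p. 28 ("`C^ℤ := C`; `C^ℚ := C^pf`; `C^ℝ := C^rlf`") and Theorem 3.6 (ix) p. 38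
("Suppose that `D` is of strongly indissectible type. If `D` is not complexifiable, then we assume
further that `Λ ≠ ℤ`. Then `F^istr` is of strongly indissectible type")
[cite: MochizukiFrdII2008, Thm 3.6 (ix) p.38].

Negative knowledge recorded next to `ArchimedeanTheoremsInstances.lean` (abc-iut-L1-t9), PROOF-ONLY (no
definition, no instance), abc-iut cell seat abc-iut-f-008 (block F, float; class `preparatory`,
kernel_closedness `parametrised`).  Parts A / B: `ArchimedeanTheoremsInstancesSchemaNegative{,B}.lean`.

As in parts A/B, the row quantifies `∀ Λ` over the FREE completion interface `pf rlf : LambdaCompletion π`.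
Junk datum used here, over the one-object base `𝟙 = Discrete PUnit` (strongly indissectible) with
`π := ` the constant functor at `Spec ℝ`: the category `0 ⇉ 1` with the structure functor
`parallelPair φ φ → F_{Φ_𝟙}` (`deg_Fr φ = 2`, so the parallel arrows are not pre-steps and both objects are
isotropic; part D of the schema file, `SchemaNegD.isIsotropic_parallelPair`) and the CONSTANT functor
`C → (0 ⇉ 1)` at `1` — it lies over `𝟙` on the nose (`over := rfl`, by the η-rules of the one-object
base).  At `Λ := ℚ` the first conjunct of `Thm36ix_CA` then is exactly the false instance
`ArchFrd.not_thm36ix_parallelPair` of part D (the pair `(left, right)` weakly dissects `1`).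

Theorems: `not_thm36ix_CA_parallelPairDatum`, `not_forall_thm36ix_CA` (¬ of the fully quantified closure,
universe level `0`).

The INSTANCE form at THE data is PROVED in the tree and is what consumers bind:
`ArchFrd.Thm36Sub.thm36ix_CA_holds` (`Thm36SubInstancesB.lean`; + `ArchFrd.thm36ix_C`, `ArchFrd.thm36ix_A`
(`ArchimedeanIndissectibleAngular.lean`, `Λ = ℤ`), `Thm36Sub.thm36ix_instance_Q`, `Thm36SubIndissectR`).  So the row is
admissible ONLY at the constructed data (FACT-LIST class «universal-closure REFUTED; instance form
PROVED»).  Nothing here bears on the disputed [IUTchIII] Cor. 3.12 or takes a side; refuted-as-schema is a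
statement about OUR typing (the interface binders), not about the paper.
-/

namespace Literature.AlgebraicGeometry.Frobenioids

namespace ArchFrd

open CategoryTheory CategoryTheory.Limits

/-! ### F-0879: `Thm36ix_CA` -/

/-- **F-0879, universal closure false:** over the one-object base `𝟙` (`π :=` the constant functor at
`Spec ℝ`), at the junk completion datum `pf := (0 ⇉ 1, Φ_𝟙, parallelPair φ φ, const 1)` with `deg_Fr φ = 2`,
the `Λ = ℚ` conjunct of `Thm36ix_CA` is the false instance of part D: `𝟙` is strongly indissectible,
`Λ = ℚ ≠ ℤ`, but `(0 ⇉ 1)^istr = (0 ⇉ 1)` is weakly dissected at `1` by `(left, right)`.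
[cite: MochizukiFrdII2008, Thm 3.6 (ix) p.38] -/
theorem not_thm36ix_CA_parallelPairDatum :
    ¬ Thm36ix_CA ((Functor.const (Discrete PUnit.{1})).obj D0.real)
        { cat := WalkingParallelPair, monoid := constMonoidOn PUnit.{1},
          str := parallelPair
            (ElemFrobenioid.homMk (A := ElemFrobenioid.of (constMonoidOn PUnit.{1}) (Discrete.mk PUnit.unit))
              (B := ElemFrobenioid.of (constMonoidOn PUnit.{1}) (Discrete.mk PUnit.unit)) (𝟙 _) 1 2)
            (ElemFrobenioid.homMk (A := ElemFrobenioid.of (constMonoidOn PUnit.{1}) (Discrete.mk PUnit.unit))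
              (B := ElemFrobenioid.of (constMonoidOn PUnit.{1}) (Discrete.mk PUnit.unit)) (𝟙 _) 1 2),
          fromC := (Functor.const _).obj WalkingParallelPair.one, over := rfl }
        (LambdaCompletion.self _) :=
  fun h => not_thm36ix_parallelPair (h.1 MonoidType.Q)

/-- **F-0879 as a schema is not a fact:** the closure of `ArchFrd.Thm36ix_CA` over all bases and completion
data (universe level `0`) is FALSE; at THE data it is `ArchFrd.Thm36Sub.thm36ix_CA_holds`.
[cite: MochizukiFrdII2008, Thm 3.6 (ix) p.38] -/
theorem not_forall_thm36ix_CA :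
    ¬ ∀ {D : Type} [Category.{0} D] (π : D ⥤ D0) (pf rlf : LambdaCompletion π), Thm36ix_CA π pf rlf :=
  fun h => not_thm36ix_CA_parallelPairDatum (h _ _ _)

end ArchFrd

end Literature.AlgebraicGeometry.Frobenioids
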